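import Summits.BirchSwinnertonDyer.BirchSwinnertonDyer.Theorems.KolyvaginRoadThreeMethod2OddSelmerRank
import Literature.NumberTheory.EllipticCurves.BSDSelmerParityDokchitserBaseChangeProofs
import Literature.NumberTheory.EllipticCurves.SelmerParityTotallyReal
import Mathlib.Analysis.Analytic.Order
import HarnessLib

/-!
# Route `KolyvaginRoadThree`, deciding crux `ZhangSharpFrameAtThreeHL` (item stmt-BirchSwinnertonDyer-19574):
# the 3-PARITY stub P `Method2.stub_oddSelmerRankAtThree` FROM THE `p`-PARITY THEOREM OVER `ℚ` BY NAME
# (Dokchitser–Dokchitser ∕ Nekovář) — no Gross–Zagier, no Kolyvagin, no Heegner hypothesis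
# (cell `bsd-stepL`, seat `bsd-stepL-zhang3-w1` g0; `--supports stmt-BirchSwinnertonDyer-19574`)

The registered METHOD skeleton v3.2 of crux 19574 (`Cruxes/ZhangSharpFrameAtThreeHL/Lines/method2.lean`,
sha16 `2e396e49c718c4ec`) carries the small stub P `stub_oddSelmerRankAtThree`: at every Hoffstein–Luo A1 frame
`(E, K, Dt, β, ι)`, `dim_𝔽₃ Sel₃(E/K)` is ODD. Two sibling files prove P's text VERBATIM modulo published inputs:
`KolyvaginRoadThreeMethod2OddSelmerRank` (koly g12, p465420: Gross–Zagier + Kolyvagin + modularity + Cassels–Tate)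
and `KolyvaginRoadThreeMethod2OddSelmerRankOfLevelInputs` (koly g16, p522478: the route binders h₁ (conjuncts 1, 2, 7)
+ hCT3). Both go through `rank E(K) = 1` and the FINITENESS of `Ш(E/K)` — i.e. through the Gross–Zagier–Kolyvagin
theorem on the frame.

This file gives the OTHER printed road to P (card `Lines/method2.md` row R9, "DD p-parity + CT"; referee g12's repair
"DD 3-parity + quadratic decomposition + CT + E(K)[3] = 0"), which never mentions a Heegner point, the rank, or the
finiteness of `Ш`:

* the `3`-PARITY THEOREM over `ℚ` (T. Dokchitser–V. Dokchitser, Ann. of Math. 172 (2010), Thm. 1.4, analytic form;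
  tree named fact `Literature.NumberTheory.EllipticCurves.selmerCorank_mod_two_eq W 3`:
  `corank_{ℤ₃} Sel_{3^∞}(E/ℚ) ≡ ord_{s=1} L(E, s) (mod 2)`), applied to `E` (`r_an(E) = 1` from `ClassX11b W 3`, so
  `s₃(E/ℚ)` is odd) and to the twist `E^{(d_K)}` (`L(E^{(d_K)}, 1) ≠ 0` gives `r_an(E^{(d_K)}) = 0` UNCONDITIONALLY —
  a non-zero value has order of vanishing `0`, Mathlib `apply_eq_zero_of_analyticOrderNatAt_ne_zero` — so
  `s₃(E^{(d_K)}/ℚ)` is even);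
* the quadratic base-change identity `s₃(E/K) = s₃(E/ℚ) + s₃(E^{(d_K)}/ℚ)` — a tree THEOREM
  (`selmerCorank_baseChange_quadratic_holds`, Dokchitser–Dokchitser Lemma 4.14 discharged in
  `BSDSelmerParityDokchitserBaseChangeProofs`), so `s₃(E/K) = corank_{ℤ₃} Sel_{3^∞}(E/K)` is ODD;
* the CASSELS–TATE pairing over `K` (tree named fact `WeierstrassCurve.exists_casselsTate_pairing`): through the tree
  theorem `exists_selmerRank_eq_add`, `#Sel₃(E/K) = 3^s`, `#E(K)[3] = 3^t` ⇒ `s = t + s₃(E/K) + 2m`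
  ("`Ш[3^∞] ≅ (ℚ₃/ℤ₃)^δ ×` finite of square order");
* `E(K)[3] = 0` (`t = 0`) from `Irr W 3` over the quadratic field `K` (tree theorem
  `torsionBy_eq_bot_of_isImaginaryQuadratic_of_hasIrreducibleModPGaloisRep`).
Hence `dim_𝔽₃ Sel₃(E/K) = s = 0 + odd + 2m` is odd.

THEOREMS (0 defs, 0 `sorry`; CONDITIONAL on the named facts displayed as hypotheses, all PUBLISHED):
* `analyticRank_eq_zero_of_entireLFunction_one_ne_zero` — `L(W, 1) ≠ 0 ⇒ ord_{s=1} L(W, s) = 0`, no continuation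
  hypothesis (any field);
* `odd_selmerCorank_baseChange_of_selmerCorank_mod_two_eq` — any prime `p`, any quadratic field `K`: `p`-parity over
  `ℚ` for `E` and `E^{(d_K)}` + `r_an(E) + r_an(E^{(d_K)})` odd ⇒ `corank_{ℤ_p} Sel_{p^∞}(E/K)` odd (NO Cassels–Tate);
* `odd_selmerRank_of_odd_selmerCorank_of_torsionBy_eq_bot` — any number field, any prime: corank odd + `E(F)[p] = 0`
  + Cassels–Tate ⇒ `#Sel_p(E/F) = p^s` with `s` odd;
* `odd_selmerRank_baseChange_of_pParity` — the two combined over a quadratic `K` with `Irr W p`;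
* `stub_oddSelmerRankAtThree_of_pParity` — THE REGISTERED STUB SIGNATURE VERBATIM as conclusion, from
  `(∀ E/ℚ, selmerCorank_mod_two_eq E 3)` and `(∀ F, exists_casselsTate_pairing F)` ONLY; of the frame hypotheses it
  consumes only `ClassX11b W 3` (for `r_an(E) = 1` and `Irr W 3`), `IsImaginaryQuadratic K` (for `[K:ℚ] = 2`) and
  `L(E^{(d_K)}, 1) ≠ 0` — the Heegner hypothesis, `β`, `Dt`, `ι`, (mult), (surj), (ram), (tam), `d_K` odd,
  `d_K ≠ −3`, the Manin condition are all idle on this road;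
* `stub_oddSelmerRankAtThree_of_nekovar` — the same from Nekovář 2013 Thm. A (tree named fact `Nekovar2013_theoremA`,
  case `F = ℚ`) + the entire continuation of `L(E/ℚ, s)` (`hasEntireLFunction_rat`) + Cassels–Tate, via the tree
  theorem `selmerCorank_mod_two_eq_of_nekovar`;
* `stub_oddSelmerRankAtThree_of_p_parity` — the same from the ROOT-NUMBER form `p_parity W 3`
  (`(-1)^{s₃} = w(E)`) + the parity of the analytic rank `even_analyticRank_iff` + Cassels–Tate, via the tree theorem
  `selmerCorank_mod_two_eq_of_p_parity`.

So P's trust base is now the DISJUNCTION of two disjoint published bases: {GZ, Kolyvagin, modularity, CT} (p465420 ∕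
p522478) or {DD 3-parity over ℚ, CT} (this file). P remains print-conditional as typed (it asserts an arithmetic
parity from an analytic hypothesis); no case of BSD is proved here. PARTITION: O2@3 (B10) × A1 × crux 19574 × stub P —
proves-glue; closes: none (T7).

References: [cite: DokchitserDokchitserAnnals2010, Thm. 1.4, Lemma 4.14] [cite: Dokchitser2013ParityNotes, §2, §4]
[cite: Nekovar2013, Thm. A] [cite: SilvermanAEC2009, Thm. X.4.14] [cite: WZhang2014, Thm. 9.2] [cite: GrossLMS1991, Prop. 2.3].
-/

noncomputable section

open scoped Classical

namespace Summit.BirchSwinnertonDyer.Rank1Residual.X11b.Three.Koly.Method2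

open WeierstrassCurve NumberField Literature.NumberTheory.EllipticCurves
  Literature.NumberTheory.EllipticCurves.ModularForms
  Literature.NumberTheory.EllipticCurves.Rank1Residual
  Summit.BirchSwinnertonDyer.Rank1Residual Summit.BirchSwinnertonDyer.Rank1Residual.X11b Module

/-! ## `L(W, 1) ≠ 0 ⇒ r_an(W) = 0`, unconditionally -/

/-- **A non-zero central value means analytic rank zero — with NO continuation hypothesis.** The tree's
`W.analyticRank` is Mathlib's `analyticOrderNatAt W.entireLFunction 1`; a function with a non-zero value at `1` has
order of vanishing `0` there whether or not it is analytic at `1` (`apply_eq_zero_of_analyticOrderNatAt_ne_zero`; the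
junk value of a non-analytic germ is `0` as well). Compare the tree's `analyticRank_eq_zero_iff_holds`, which gives the
converse too but asks `W.HasEntireLFunction`. [folklore] -/
theorem analyticRank_eq_zero_of_entireLFunction_one_ne_zero {F : Type} [Field F] [NumberField F]
    (W : WeierstrassCurve F) (h : W.entireLFunction 1 ≠ 0) : W.analyticRank = 0 := by
  by_contra hr
  exact h (apply_eq_zero_of_analyticOrderNatAt_ne_zero (f := W.entireLFunction) hr)

/-! ## The `p^∞`-Selmer corank over a quadratic field from `p`-parity over `ℚ` -/

/-- **Odd `p^∞`-Selmer corank over a quadratic field from the `p`-parity theorem over `ℚ`.** For `E/ℚ`, a quadratic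
field `K` (discriminant `d_K`) and a prime `p`: if `corank_{ℤ_p} Sel_{p^∞}(·/ℚ) ≡ r_an(·) (mod 2)` holds for `E` and
for `E^{(d_K)}` (Dokchitser–Dokchitser 2010 Thm. 1.4, the tree's `selmerCorank_mod_two_eq · p`) and
`r_an(E) + r_an(E^{(d_K)})` is odd, then `corank_{ℤ_p} Sel_{p^∞}(E/K)` is odd — by the tree THEOREM
`corank Sel_{p^∞}(E/K) = corank Sel_{p^∞}(E/ℚ) + corank Sel_{p^∞}(E^{(d_K)}/ℚ)` (`selmerCorank_baseChange_quadratic_holds`,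
Dokchitser–Dokchitser Lemma 4.14). No Cassels–Tate, no Gross–Zagier, no Kolyvagin.
[cite: DokchitserDokchitserAnnals2010, Thm. 1.4 and Lemma 4.14] -/
theorem odd_selmerCorank_baseChange_of_selmerCorank_mod_two_eq (W : WeierstrassCurve ℚ) [W.IsElliptic]
    (K : Type) [Field K] [NumberField K] (hK2 : Module.finrank ℚ K = 2) (p : ℕ) [Fact p.Prime]
    (hE : selmerCorank_mod_two_eq W p)
    (hEd : selmerCorank_mod_two_eq (W.quadraticTwist (NumberField.discr K : ℚ)) p)
    (hodd : Odd (W.analyticRank + (W.quadraticTwist (NumberField.discr K : ℚ)).analyticRank)) :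
    Odd ((W.baseChange K).selmerCorank p) := by
  rw [selmerCorank_baseChange_quadratic_holds W K hK2 p, Nat.odd_iff, Nat.add_mod]
  have h1 : W.selmerCorank p % 2 = W.analyticRank % 2 := hE
  have h2 : (W.quadraticTwist (NumberField.discr K : ℚ)).selmerCorank p % 2 =
      (W.quadraticTwist (NumberField.discr K : ℚ)).analyticRank % 2 := hEd
  rw [h1, h2, ← Nat.add_mod]
  exact Nat.odd_iff.mp hodd

/-! ## Odd corank + no `p`-torsion + Cassels–Tate ⇒ odd `p`-Selmer rank (any number field) -/

/-- **Odd `p`-Selmer rank from an odd `p^∞`-Selmer corank.** For an elliptic curve `E` over a number field `F` and a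
prime `p` with `E(F)[p] = 0` and `corank_{ℤ_p} Sel_{p^∞}(E/F)` odd, granting the Cassels–Tate pairing on `Ш(E/F)`:
`#Sel_p(E/F) = p^s` with `s` ODD — `s = t + corank + 2m` (tree `exists_selmerRank_eq_add`: "`Ш[p^∞] ≅ (ℚ_p/ℤ_p)^δ ×`
(finite of square order)") with `t = 0`. [cite: Dokchitser2013ParityNotes, §2 (first display)]
[cite: SilvermanAEC2009, Thm. X.4.14] -/
theorem odd_selmerRank_of_odd_selmerCorank_of_torsionBy_eq_bot {F : Type} [Field F] [NumberField F]
    (E : WeierstrassCurve F) [E.IsElliptic] (hCT : exists_casselsTate_pairing (K := F)) (p : ℕ) [Fact p.Prime]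
    (hcorank : Odd (E.selmerCorank p))
    (htors : AddSubgroup.torsionBy E.toAffine.Point ((p : ℕ) : ℤ) = ⊥) :
    ∃ s : ℕ, Odd s ∧ Nat.card (E.selmerGroup ((p : ℕ) : ℤ)) = p ^ s := by
  obtain ⟨s, hs⟩ := exists_natCard_selmerGroup_eq_pow E p
  have ht : Nat.card (AddSubgroup.torsionBy E.toAffine.Point ((p : ℕ) : ℤ)) = p ^ 0 := by
    rw [htors, pow_zero, AddSubgroup.card_bot]
  obtain ⟨m, hm⟩ := exists_selmerRank_eq_add hCT E p s 0 hs ht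
  refine ⟨s, ?_, hs⟩
  rw [hm, zero_add, Nat.odd_add]
  exact iff_of_true hcorank (even_two_mul m)

/-- **Odd `p`-Selmer rank over a quadratic field from `p`-parity over `ℚ`** (the two previous lemmas combined). For
`E/ℚ` with `E[p]` irreducible (so `E(K)[p] = 0` over every quadratic `K`, tree
`torsionBy_eq_bot_of_hasIrreducibleModPGaloisRep`), a quadratic field `K`, a prime `p`, the `p`-parity theorem over
`ℚ` for `E` and `E^{(d_K)}`, `r_an(E) + r_an(E^{(d_K)})` odd, and the Cassels–Tate pairing over `K`:
`#Sel_p(E/K) = p^s` with `s` odd. [cite: DokchitserDokchitserAnnals2010, Thm. 1.4 and Lemma 4.14]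
[cite: SilvermanAEC2009, Thm. X.4.14] -/
theorem odd_selmerRank_baseChange_of_pParity (W : WeierstrassCurve ℚ) [W.IsElliptic]
    (K : Type) [Field K] [NumberField K] (hK2 : Module.finrank ℚ K = 2) (p : ℕ) [Fact p.Prime]
    (hirr : W.HasIrreducibleModPGaloisRep p)
    (hE : selmerCorank_mod_two_eq W p)
    (hEd : selmerCorank_mod_two_eq (W.quadraticTwist (NumberField.discr K : ℚ)) p)
    (hodd : Odd (W.analyticRank + (W.quadraticTwist (NumberField.discr K : ℚ)).analyticRank))
    (hCT : exists_casselsTate_pairing (K := K)) :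
    ∃ s : ℕ, Odd s ∧ Nat.card ((W.baseChange K).selmerGroup ((p : ℕ) : ℤ)) = p ^ s :=
  odd_selmerRank_of_odd_selmerCorank_of_torsionBy_eq_bot (W.baseChange K) hCT p
    (odd_selmerCorank_baseChange_of_selmerCorank_mod_two_eq W K hK2 p hE hEd hodd)
    (torsionBy_eq_bot_of_hasIrreducibleModPGaloisRep W K hK2 (Fact.out : p.Prime) hirr)

/-! ## The stub from the `3`-parity theorem over `ℚ` (Dokchitser–Dokchitser) and Cassels–Tate -/

/-- **`Method2.stub_oddSelmerRankAtThree` (v3.2) FROM THE 3-PARITY THEOREM OVER `ℚ` — the registered signature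
VERBATIM.** At every Hoffstein–Luo A1 frame `dim_𝔽₃ Sel₃(E/K)` is odd: `r_an(E) = 1` (`ClassX11b W 3`) and
`r_an(E^{(d_K)}) = 0` (`L(E^{(d_K)}, 1) ≠ 0`, unconditionally), so by Dokchitser–Dokchitser's `3`-parity theorem over
`ℚ` (`selmerCorank_mod_two_eq · 3`, for `E` and `E^{(d_K)}`) and the proved quadratic decomposition
`s₃(E/K) = s₃(E/ℚ) + s₃(E^{(d_K)}/ℚ)` the corank `s₃(E/K)` is odd; `E(K)[3] = 0` (`Irr W 3`); Cassels–Tate over `K`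
makes `dim_𝔽₃ Sel₃(E/K) ≡ s₃(E/K) (mod 2)`. CONDITIONAL on the two named facts displayed (both published); it uses
neither Gross–Zagier nor Kolyvagin nor modularity nor the Heegner hypothesis of the frame.
[cite: DokchitserDokchitserAnnals2010, Thm. 1.4] [cite: SilvermanAEC2009, Thm. X.4.14] [cite: WZhang2014, Thm. 9.2] -/
theorem stub_oddSelmerRankAtThree_of_pParity
    (hDD : ∀ (V : WeierstrassCurve ℚ) [V.IsElliptic], selmerCorank_mod_two_eq V 3)
    (hCT : ∀ (F : Type) [Field F] [NumberField F], exists_casselsTate_pairing (K := F)) :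
    ∀ (W : WeierstrassCurve ℚ) [W.IsElliptic] [W.IsGloballyMinimal] [NeZero (W.conductorNorm ℤ)] (K : Type)
      [Field K] [NumberField K] (Dt : ModularParametrizationData W (W.conductorNorm ℤ)) (β : ℤ) (ι : K →+* ℂ),
      Summit.BirchSwinnertonDyer.Rank1Residual.ClassX11b W 3 → W.HasMultiplicativeReductionAtPrime 3 →
      Rank1Residual.Surj W 3 → Rank1Residual.Ram W 3 → ¬ 3 ∣ W.tamagawaProduct → IsImaginaryQuadratic K →
      Odd (NumberField.discr K) → SatisfiesHeegnerHypothesis (W.conductorNorm ℤ) K →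
      (W.quadraticTwist (NumberField.discr K : ℚ)).entireLFunction 1 ≠ 0 → NumberField.discr K ≠ -3 →
      (4 * (W.conductorNorm ℤ : ℤ)) ∣ β ^ 2 - NumberField.discr K → ¬ (3 : ℤ) ∣ Dt.c →
      ∀ [Module (ZMod 3) (V3 W K)],
      Odd (finrank (ZMod 3)
        (AddSubgroup.toZModSubmodule 3 (selmerGroup (W.baseChange K) ((3 ^ 1 : ℕ) : ℤ)))) := by
  intro W _ _ _ K _ _ Dt β ι hX _hmult _hsurj _hram _htam hK _hodd _hH hLt _h3 _hβ _hc _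
  haveI : Fact (Nat.Prime 3) := ⟨Nat.prime_three⟩
  haveI : (W.quadraticTwist (NumberField.discr K : ℚ)).IsElliptic :=
    W.isElliptic_quadraticTwist (Int.cast_ne_zero.mpr (NumberField.discr_ne_zero K))
  -- `r_an(E) = 1`, `r_an(E^{(d_K)}) = 0`
  have hodd : Odd (W.analyticRank + (W.quadraticTwist (NumberField.discr K : ℚ)).analyticRank) := by
    rw [hX.1, analyticRank_eq_zero_of_entireLFunction_one_ne_zero _ hLt]
    exact odd_one
  obtain ⟨s, hsodd, hs⟩ := odd_selmerRank_baseChange_of_pParity W K hK.1 3 hX.2.2.2 (hDD W)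
    (hDD (W.quadraticTwist (NumberField.discr K : ℚ))) hodd (hCT K)
  rw [finrank_selmer_eq_of_natCard_eq_pow (W.baseChange K) hs]
  exact hsodd

/-! ## The same from Nekovář 2013 Thm. A (case `F = ℚ`) and from the root-number form `p_parity` -/

/-- **`Method2.stub_oddSelmerRankAtThree` FROM NEKOVÁŘ'S `p`-PARITY THEOREM (2013, Thm. A, `F = ℚ`).** Theorem A
over the totally real field `ℚ` (odd degree, so its cases (1)–(2) cover every `E/ℚ`), together with the entire
continuation of `L(E/ℚ, s)` (`hasEntireLFunction_rat`, Wiles ∕ Breuil–Conrad–Diamond–Taylor — Theorem A reads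
`ord_{s=1}` of the continued `L`-function), yields the `3`-parity theorem over `ℚ` (tree theorem
`selmerCorank_mod_two_eq_of_nekovar`); then `stub_oddSelmerRankAtThree_of_pParity`. CONDITIONAL on the three named
facts displayed (all published). [cite: Nekovar2013, Thm. A] [cite: SilvermanAEC2009, Thm. X.4.14] -/
theorem stub_oddSelmerRankAtThree_of_nekovar (hN : Nekovar2013_theoremA) (hL : hasEntireLFunction_rat)
    (hCT : ∀ (F : Type) [Field F] [NumberField F], exists_casselsTate_pairing (K := F)) :
    ∀ (W : WeierstrassCurve ℚ) [W.IsElliptic] [W.IsGloballyMinimal] [NeZero (W.conductorNorm ℤ)] (K : Type)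
      [Field K] [NumberField K] (Dt : ModularParametrizationData W (W.conductorNorm ℤ)) (β : ℤ) (ι : K →+* ℂ),
      Summit.BirchSwinnertonDyer.Rank1Residual.ClassX11b W 3 → W.HasMultiplicativeReductionAtPrime 3 →
      Rank1Residual.Surj W 3 → Rank1Residual.Ram W 3 → ¬ 3 ∣ W.tamagawaProduct → IsImaginaryQuadratic K →
      Odd (NumberField.discr K) → SatisfiesHeegnerHypothesis (W.conductorNorm ℤ) K →
      (W.quadraticTwist (NumberField.discr K : ℚ)).entireLFunction 1 ≠ 0 → NumberField.discr K ≠ -3 →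
      (4 * (W.conductorNorm ℤ : ℤ)) ∣ β ^ 2 - NumberField.discr K → ¬ (3 : ℤ) ∣ Dt.c →
      ∀ [Module (ZMod 3) (V3 W K)],
      Odd (finrank (ZMod 3)
        (AddSubgroup.toZModSubmodule 3 (selmerGroup (W.baseChange K) ((3 ^ 1 : ℕ) : ℤ)))) :=
  haveI : Fact (Nat.Prime 3) := ⟨Nat.prime_three⟩
  stub_oddSelmerRankAtThree_of_pParity (fun V _ ↦ selmerCorank_mod_two_eq_of_nekovar hN hL V 3) hCT

/-- **`Method2.stub_oddSelmerRankAtThree` FROM THE ROOT-NUMBER FORM OF THE `3`-PARITY THEOREM.** Dokchitser–Dokchitser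
2010 Thm. 1.4 as printed, `(-1)^{corank Sel_{3^∞}(E/ℚ)} = w(E)` (tree named fact `p_parity W 3`), with the parity of
the analytic rank `Even (ord_{s=1} L(E, s)) ↔ w(E) = +1` (tree named fact `W.even_analyticRank_iff`, the functional
equation) gives the analytic form (tree theorem `selmerCorank_mod_two_eq_of_p_parity`); then
`stub_oddSelmerRankAtThree_of_pParity`. CONDITIONAL on the three named facts displayed (all published).
[cite: DokchitserDokchitserAnnals2010, Thm. 1.4] [cite: SilvermanAEC2009, Thm. X.4.14] -/
theorem stub_oddSelmerRankAtThree_of_p_parity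
    (hpar : ∀ V : WeierstrassCurve ℚ, V.even_analyticRank_iff)
    (hP : ∀ (V : WeierstrassCurve ℚ) [V.IsElliptic], p_parity V 3)
    (hCT : ∀ (F : Type) [Field F] [NumberField F], exists_casselsTate_pairing (K := F)) :
    ∀ (W : WeierstrassCurve ℚ) [W.IsElliptic] [W.IsGloballyMinimal] [NeZero (W.conductorNorm ℤ)] (K : Type)
      [Field K] [NumberField K] (Dt : ModularParametrizationData W (W.conductorNorm ℤ)) (β : ℤ) (ι : K →+* ℂ),
      Summit.BirchSwinnertonDyer.Rank1Residual.ClassX11b W 3 → W.HasMultiplicativeReductionAtPrime 3 →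
      Rank1Residual.Surj W 3 → Rank1Residual.Ram W 3 → ¬ 3 ∣ W.tamagawaProduct → IsImaginaryQuadratic K →
      Odd (NumberField.discr K) → SatisfiesHeegnerHypothesis (W.conductorNorm ℤ) K →
      (W.quadraticTwist (NumberField.discr K : ℚ)).entireLFunction 1 ≠ 0 → NumberField.discr K ≠ -3 →
      (4 * (W.conductorNorm ℤ : ℤ)) ∣ β ^ 2 - NumberField.discr K → ¬ (3 : ℤ) ∣ Dt.c →
      ∀ [Module (ZMod 3) (V3 W K)],
      Odd (finrank (ZMod 3)
        (AddSubgroup.toZModSubmodule 3 (selmerGroup (W.baseChange K) ((3 ^ 1 : ℕ) : ℤ)))) :=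
  haveI : Fact (Nat.Prime 3) := ⟨Nat.prime_three⟩
  stub_oddSelmerRankAtThree_of_pParity (fun V _ ↦ selmerCorank_mod_two_eq_of_p_parity V 3 (hpar V) (hP V)) hCT

end Summit.BirchSwinnertonDyer.Rank1Residual.X11b.Three.Koly.Method2

end
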